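import Literature.Computability.Cryptography.BLPRSReduction
import Literature.Computability.Cryptography.LWEPiLawMaps
import HarnessLib

/-!
# Coin slices of the machine versus the randomised runs of the analysis: the kernel identity and the solver identity (MP12 Thm. 3.1 / BLPRS Thm. 2.17, machine bridge)

Topic `Computability/Cryptography` (LWE), grouping namespace `LWE.MP12`, sequel of
`BLPRSReduction.lean` (`taggedDistinguisher`, `taggedSearchSolver`, `OracleAlg.randRun`) and
`LWEPiLawMaps.lean`. Proved material (no named fact) towards
`Literature.Computability.Cryptography.blprs_gapSVP_sqrt_dim_to_lwe_classical` (**pqc.S21**),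
hypothesis `h₂` of `blprs_gapSVP_sqrt_dim_to_lwe_classical_of_components`.

The analysis of the Micciancio–Peikert reduction speaks of a KERNEL `K u : PMF Bool` (the randomised
distinguisher's verdict on the query block `u`) and of the solver as a KERNEL on sample tuples; the
machine reads a fixed-length slice of uniform coins per call and a fixed-length prefix of its own
uniform coin string. This file identifies the two:

* `uniform_map_restrictFin`, `uniformVector_map_toList`, `ofFn_restrictFin_eq_take`,
  `uniformVector_map_prefixFn` — a prefix of uniform coins is uniform (exactly);
* `kernelSample D O coinsD fuelD n u c` — the verdict of `D^O` on the tagged code of `u` with the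
  coins cut from the slice `c : Fin ℓ → Bool`; **`uniform_map_kernelSample`**: its law under a
  uniform slice IS `taggedDistinguisher D O coinsD fuelD n d Q m u` (whenever `ℓ` covers the coins
  `D` reads on that query);
* **`taggedSearchSolver_eq_map`**: if the machine `R` on input `⟨⟨1ⁿ, S⟩, r⟩` outputs the code of
  `G S (prefix of r)`, its solver kernel is `S ↦ U.map (G S)`; **`searchSuccessProb_ge_of_forall`**:
  a pointwise bound for every secret bounds the average-case success probability.

## References

* D. Micciancio, C. Peikert, *Trapdoors for lattices: simpler, tighter, faster, smaller*, EUROCRYPT 2012,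
  LNCS 7237; full version IACR ePrint 2011/501, §3, Thm. 3.1. [MicciancioPeikert2012]
* S. Arora, B. Barak, *Computational Complexity: A Modern Approach*, CUP 2009, Def. 7.1 (a
  probabilistic machine is a deterministic machine reading a random string). [AroraBarak2009]
-/

noncomputable section

open scoped ENNReal

namespace Literature.Computability.Cryptography

namespace LWE

namespace MP12

open Literature.Probability.Distributions Literature.Computability.Complexity _root_.Computability BLPRS2013

/-! ### Prefixes of uniform coins -/

section Prefix

/-- Restricting a coin slice to its first `k` coins. [folklore] -/
def restrictFin {ℓ k : ℕ} (hk : k ≤ ℓ) (c : Fin ℓ → Bool) : Fin k → Bool := fun i => c (Fin.castLE hk i)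

/-- **A prefix of uniform coins is uniform.** [cite: AroraBarak2009, Def. 7.1] -/
theorem uniform_map_restrictFin {ℓ k : ℕ} (hk : k ≤ ℓ) :
    (PMF.uniformOfFintype (Fin ℓ → Bool)).map (restrictFin hk) = PMF.uniformOfFintype (Fin k → Bool) := by
  classical
  rw [uniformOfFintype_arrow_eq_piLaw, uniformOfFintype_arrow_eq_piLaw]
  exact piLaw_map_restrict (Fin.castLEEmb hk) fun _ => PMF.uniformOfFintype Bool

/-- The list of the restricted slice is the prefix of the list. [folklore] -/
theorem ofFn_restrictFin_eq_take {ℓ k : ℕ} (hk : k ≤ ℓ) (c : Fin ℓ → Bool) :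
    List.ofFn (restrictFin hk c) = (List.ofFn c).take k := by
  apply List.ext_getElem
  · simp [Nat.min_eq_left hk]
  · intro i h₁ h₂
    simp [restrictFin]

/-- **Uniform vectors, as lists, are uniform tuples listed.** [folklore] -/
theorem uniformVector_map_toList (k : ℕ) :
    (PMF.uniformOfFintype (List.Vector Bool k)).map List.Vector.toList =
      (PMF.uniformOfFintype (Fin k → Bool)).map List.ofFn := by
  rw [← uniformOfFintype_map_equiv (Equiv.vectorEquivFin Bool k).symm, PMF.map_comp]
  congr 1
  funext f
  exact List.Vector.toList_ofFn f

/-- **The first `L` coins of a uniform vector of length `c ≥ L`, as a tuple, are uniform.** [cite: AroraBarak2009, Def. 7.1] -/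
theorem uniformVector_map_prefixFn {c L : ℕ} (hL : L ≤ c) :
    (PMF.uniformOfFintype (List.Vector Bool c)).map (fun r (i : Fin L) => r.toList.getD i false) =
      PMF.uniformOfFintype (Fin L → Bool) := by
  have h : (fun (r : List.Vector Bool c) (i : Fin L) => r.toList.getD i false) =
      (fun (l : List Bool) (i : Fin L) => l.getD i false) ∘ List.Vector.toList := rfl
  rw [h, ← PMF.map_comp, uniformVector_map_toList, PMF.map_comp, ← uniform_map_restrictFin hL]
  congr 1
  funext f
  funext i
  simp only [Function.comp_apply, restrictFin]
  rw [List.getD_eq_getElem _ _ (by simp; omega)]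
  simp only [List.getElem_ofFn]
  rfl

end Prefix

/-! ### The kernel identity -/

section Kernel

variable (D : OracleAlg Bool) (O : Oracle) (coinsD fuelD : Polynomial ℕ) (n : ℕ) {d Q m ℓ : ℕ}

/-- The tagged code of a query block: `⟨1ⁿ, code of u⟩`. [cite: BrakerskiEtAl2013, Thm. 2.17 (interface)] -/
def tagged (u : Fin m → (Fin d → ZMod Q) × ZMod Q) : List Bool := boolPair (unaryEncodeNat n) (encodeLWESamples u)

/-- **The kernel sample**: the verdict of `D^O` on the tagged code of `u`, its coins cut from the slice
`c` (the first `coinsD(|⟨1ⁿ, u⟩|)` of them), a time-out read as `false`. [cite: AroraBarak2009, Def. 7.1] -/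
def kernelSample (u : Fin m → (Fin d → ZMod Q) × ZMod Q) (c : Fin ℓ → Bool) : Bool :=
  (D.run O (fuelD.eval (tagged n u).length)
    (boolPair (tagged n u) ((List.ofFn c).take (coinsD.eval (tagged n u).length)))).getD false

/-- **The kernel identity**: under a uniform slice covering the coins `D` reads on the query, the kernel
sample has the law of the tagged distinguisher. [cite: AroraBarak2009, Def. 7.1] -/
theorem uniform_map_kernelSample (u : Fin m → (Fin d → ZMod Q) × ZMod Q) (hℓ : coinsD.eval (tagged n u).length ≤ ℓ) :
    (PMF.uniformOfFintype (Fin ℓ → Bool)).map (kernelSample D O coinsD fuelD n u) =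
      taggedDistinguisher D O coinsD fuelD n d Q m u := by
  have h : kernelSample D O coinsD fuelD n u (ℓ := ℓ) =
      (fun l : List Bool => (D.run O (fuelD.eval (tagged n u).length) (boolPair (tagged n u) l)).getD false) ∘
        List.ofFn ∘ restrictFin hℓ := by
    funext c
    simp only [kernelSample, Function.comp_apply, ofFn_restrictFin_eq_take]
  rw [h, ← PMF.map_comp, ← PMF.map_comp, uniform_map_restrictFin, ← uniformVector_map_toList, taggedDistinguisher,
    OracleAlg.randRun, PMF.map_comp, PMF.map_comp]
  rfl

end Kernel

/-! ### The solver identity and the average-case success probability -/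

section SolverId

variable (R : OracleAlg (List Bool)) (O : Oracle) (coinsR fuelR : Polynomial ℕ) (n : ℕ) {d Q m L : ℕ}

/-- **The solver identity**: if on every input tuple `S` and coin string `r` (of the length `randRun`
draws) the machine outputs the code of `G S (first L coins of r)`, and `L` never exceeds that length,
then its solver kernel is `S ↦ U.map (G S)`. [cite: AroraBarak2009, Def. 7.1] -/
theorem taggedSearchSolver_eq_map (G : (Fin m → (Fin d → ZMod Q) × ZMod Q) → (Fin L → Bool) → (Fin d → ZMod Q))
    (hL : ∀ S : Fin m → (Fin d → ZMod Q) × ZMod Q, L ≤ coinsR.eval (tagged n S).length)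
    (hR : ∀ (S : Fin m → (Fin d → ZMod Q) × ZMod Q) (r : List.Vector Bool (coinsR.eval (tagged n S).length)),
      decodeSecret d Q ((R.run O (fuelR.eval (tagged n S).length) (boolPair (tagged n S) r.toList)).getD []) =
        G S fun i => r.toList.getD i false) :
    taggedSearchSolver R O coinsR fuelR n d Q m = fun S => (PMF.uniformOfFintype (Fin L → Bool)).map (G S) := by
  funext S
  rw [taggedSearchSolver, OracleAlg.randRun, PMF.map_comp, ← uniformVector_map_prefixFn (hL S), PMF.map_comp]
  congr 1
  funext r
  exact hR S r

variable {ι R' : Type} [Fintype ι] [DecidableEq ι] [CommRing R'] [Fintype R'] [Nonempty (ι → R')]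

/-- **A bound for every secret bounds the average-case success probability.** [cite: RegevLWE2009, §4] -/
theorem searchSuccessProb_ge_of_forall (χ : PMF R') (m : ℕ) (A : Solver ι R' m) {θ : ℝ≥0∞}
    (h : ∀ s, θ ≤ searchSuccessProbOf χ m A s) : θ ≤ searchSuccessProb χ m A := by
  unfold searchSuccessProb
  calc θ = ∑ s, PMF.uniformOfFintype (ι → R') s * θ := by
        rw [← Finset.sum_mul, ← tsum_fintype (L := SummationFilter.unconditional _), PMF.tsum_coe, one_mul]
    _ ≤ ∑ s, PMF.uniformOfFintype (ι → R') s * searchSuccessProbOf χ m A s :=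
        Finset.sum_le_sum fun s _ => mul_le_mul_right (h s) _

end SolverId

end MP12

end LWE

end Literature.Computability.Cryptography

end
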